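import Summits.QuantumFields.YangMills.Theorems.BalabanLadderIRAbstractBasinRung8
import HarnessLib

/-!
# The abstract purity basin from `2⁻⁶`: square in time FIRST, then extend — the volume-law map `δ ↦ 32δ²(1+o(1))`

HONEST FRAMING.  Nothing here proves the Yang–Mills mass gap (Clay), a lattice gap, the crux `BalabanLadder.IR` (stmt-QuantumFields-19354) or its
seed; `R4` closes only the conditional finite-𝕋⁴ rung `BalabanLadder.UV`.  Sorry-free POSITIVE GLUE over tree names (helper for item 19354, line
`basin-transfer` of ideator ym-ir-idea-9 — this file PROVES that line's rank-2 stub `AbstractBasin (1/2^6) (1/2^8)`; RULING director-ym g9-№2):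
model-free reflection-positivity bookkeeping valid for every compact gauge group at every `β ≥ 0`.  All Yang–Mills content stays in the hypotheses
`ColdExitAt (1/2^6)`, `AFToColdPressure`, `IRnsc`.

CONTENT — ORDER OF OPERATIONS.  The landed rungs (`abstractBasin_two_pow_9`, `_8`) extend the cube `L³ → (2L)³` at the SHORT time `t = ⌊L/4⌋` and square in
time afterwards; the spatial extension then costs `27` resp. `(8/3)³ ≈ 19` against the purity `Y_t ≈ δ/2`.  Squaring in time FIRST, on the small cube
(free: `exc_{2t}(L³) ≤ exc_t(L³)² ≈ δ²/4`, tree `exc_two_mul_le_sq` + `exc_le_sharp`), and extending at the LONG time `c = 2t` (ym-ir-idea-13's landed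
`cube_extension_sharp`: ratio `2L/(L − 2t) ≤ 4`, factor `64`) gives `Y_{2t}((2L)³) ≤ 16 δ²(1+2δ)⁴`, hence
`δ(2L) ≤ 2(exp(16 δ²(1+2δ)⁴) − 1) ≤ 37 u²` for `δ ≤ u ≤ 2⁻⁶` — the VOLUME-LAW map `δ ↦ 32δ²(1+o(1))` (entry threshold `≈ 1/39`), with no volume bounds used.
* `abstractBasin_two_pow_6 : AbstractBasin (1/2^6) (1/2^8)` (two doublings: `37·2⁻¹² ≤ 2⁻⁶`, `37³·2⁻²⁴ ≤ 2⁻⁸`) — the stub `BasinTransfer.stub_abstractBasin64` verbatim;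
* `abstractBasin_two_pow_6_epsStar : AbstractBasin (1/2^6) epsStar`;
* `IR_of_exitAt6 : ColdExitAt (1/2^6) → AFToColdPressure → IRnsc → BalabanLadder.IR` — the bill of record re-based on a seed at ONE tolerance `2⁻⁶ ≈ 1.6 %` at ONE
  cold `4:1` torus (SU(2), β_W = 2.4, glueball-gas synthesis: side `≈ 42a ≈ 5 fm`).
CEILING (honest): `AbstractBasin θ₀ _` is FALSE for `θ₀ ≥ 1/2` (two degenerate vacua are a fixed point of every such bookkeeping); this map enters at `≈ 1/39`;
the interval `(1/39, 1/2)` is the open abstract question (line `basin-transfer`, idea «modular-moment»).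

Sources: tree `AspectBootstrap.cube_extension_sharp`, `defect_facts`, `exc_two_mul_le_sq`, `exc_eq_exp_Yfun`, `Yfun_le_exc`, `exc_antitone`, `BasinRung.exc_le_sharp`,
`BasinRung.abstractBasin_two_pow_8_epsStar`, `BasinRung.IR_of_exitAt8`; Mathlib `Real.abs_exp_sub_one_sub_id_le`.
-/

set_option autoImplicit false

noncomputable section

open MeasureTheory Filter Topology
open Literature.MathematicalPhysics.QuantumFieldTheory Literature.MathematicalPhysics.QuantumLattice
open Summit.QuantumFields.YangMills.Cruxes.IR.ColdPressurePincer
open Summit.QuantumFields.YangMills.Cruxes.IR.ColdPurityBridge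
open Summit.QuantumFields.YangMills.Cruxes.IR.AspectBootstrap

namespace Summit.QuantumFields.YangMills.Cruxes.IR.BasinRung

section Rung6
variable {Z : ℕ → ℕ → ℕ → ℕ → ℝ}

/-- **Time-first squaring at exact doubling** (no volume bounds): for `L ≥ 8`, `δ = boxDefect Z L ≤ 1/2`:
`boxDefect Z (2L) ≤ 2 (exp (16 δ² (1+2δ)⁴) − 1)`. -/
theorem defectSquaring_double_timeFirst (hS : IsAxisSymmetric Z) (hT : IsTracePositive Z)
    (L : ℕ) (hL : 8 ≤ L) (hhalf : boxDefect Z L ≤ 1 / 2) :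
    boxDefect Z (2 * L) ≤ 2 * (Real.exp (16 * boxDefect Z L ^ 2 * (1 + 2 * boxDefect Z L) ^ 4) - 1) := by
  set L' := 2 * L with hL'def
  obtain ⟨k, hk⟩ : ∃ k, L / 4 = k + 2 := ⟨L / 4 - 2, by omega⟩
  obtain ⟨k', hk'⟩ : ∃ k', L' / 4 = k' + 2 := ⟨L' / 4 - 2, by omega⟩
  have hkk' : 2 * k + 2 ≤ k' := by omega
  have h4k : 4 * (k + 2) ≤ L := by omega
  have hLL' : L ≤ L' := by omega
  have hL2 : 2 ≤ L := by omega
  have hL'2 : 2 ≤ L' := by omega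
  have hz : HasSpectralDatum (Z L L L) := hT L L L hL2 hL2 hL2
  have hz' : HasSpectralDatum (Z L' L' L') := hT L' L' L' hL'2 hL'2 hL'2
  simp only [boxDefect, hk] at hhalf
  simp only [boxDefect, hk, hk']
  obtain ⟨hδ0, -, -, -⟩ := defect_facts hz k
  obtain ⟨-, -, hδ'x, -⟩ := defect_facts hz' k'
  set δ : ℝ := 1 - Z L L L (2 * (k + 2)) / Z L L L (k + 2) ^ 2 with hδdef
  set δ' : ℝ := 1 - Z L' L' L' (2 * (k' + 2)) / Z L' L' L' (k' + 2) ^ 2 with hδ'def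
  -- (1) purity of the small cube at time t: exc_t ≤ δ(1+2δ)²/2
  have hx : exc (Z L L L) (k + 2) ≤ δ * (1 + 2 * δ) ^ 2 / 2 := exc_le_sharp hz k hhalf le_rfl
  have hx0 : 0 ≤ exc (Z L L L) (k + 2) := exc_nonneg hz k
  -- (2) square in time on the small cube: exc_{2t} ≤ exc_t²
  have h2t : 2 * (k + 2) = 2 * k + 2 + 2 := by ring
  have hx2 : exc (Z L L L) (2 * k + 2 + 2) ≤ exc (Z L L L) (k + 2) ^ 2 := by
    have := exc_two_mul_le_sq hz k
    rwa [h2t] at this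
  have hx2' : exc (Z L L L) (2 * k + 2 + 2) ≤ (δ * (1 + 2 * δ) ^ 2 / 2) ^ 2 :=
    hx2.trans (pow_le_pow_left₀ hx0 hx 2)
  -- (3) Y_{2t}(L³) ≤ exc_{2t}(L³)
  have hY : Yfun (Z L L L) (2 * k + 2 + 2) ≤ (δ * (1 + 2 * δ) ^ 2 / 2) ^ 2 := (Yfun_le_exc hz (2 * k + 2)).trans hx2'
  have hY0 : 0 ≤ Yfun (Z L L L) (2 * k + 2 + 2) := Yfun_nonneg hz (2 * k + 2)
  -- (4) sharp cube extension at the LONG time c = 2t: ratio 2L/(L − 2t) ≤ 4, factor 64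
  have hcL : 2 * k + 2 + 2 < L := by omega
  have e := cube_extension_sharp hS hT (c := 2 * k + 2 + 2) (L := L) (L' := L') (by omega) hcL hLL'
  have hLr : (0 : ℝ) < (L : ℝ) - ((2 * k + 2 + 2 : ℕ) : ℝ) := by
    have : ((2 * k + 2 + 2 : ℕ) : ℝ) < (L : ℝ) := by exact_mod_cast hcL
    linarith
  have hq : (L' : ℝ) / ((L : ℝ) - ((2 * k + 2 + 2 : ℕ) : ℝ)) ≤ 4 := by
    rw [div_le_iff₀ hLr, hL'def]
    have h4k' : (4 : ℝ) * ((k + 2 : ℕ) : ℝ) ≤ (L : ℝ) := by exact_mod_cast h4k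
    push_cast at h4k' ⊢
    linarith
  have hq0 : 0 ≤ (L' : ℝ) / ((L : ℝ) - ((2 * k + 2 + 2 : ℕ) : ℝ)) := div_nonneg (by positivity) hLr.le
  have hq3 : ((L' : ℝ) / ((L : ℝ) - ((2 * k + 2 + 2 : ℕ) : ℝ))) ^ 3 ≤ 64 := by
    calc ((L' : ℝ) / ((L : ℝ) - ((2 * k + 2 + 2 : ℕ) : ℝ))) ^ 3 ≤ (4 : ℝ) ^ 3 := pow_le_pow_left₀ hq0 hq 3
      _ = 64 := by norm_num
  have hY' : Yfun (Z L' L' L') (2 * k + 2 + 2) ≤ 16 * δ ^ 2 * (1 + 2 * δ) ^ 4 := by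
    have e' : Yfun (Z L' L' L') (2 * k + 2 + 2) ≤
        ((L' : ℝ) / ((L : ℝ) - ((2 * k + 2 + 2 : ℕ) : ℝ))) ^ 3 * Yfun (Z L L L) (2 * k + 2 + 2) := by
      simpa using e
    have e'' : Yfun (Z L' L' L') (2 * k + 2 + 2) ≤ 64 * Yfun (Z L L L) (2 * k + 2 + 2) :=
      e'.trans (mul_le_mul_of_nonneg_right hq3 hY0)
    have : 64 * Yfun (Z L L L) (2 * k + 2 + 2) ≤ 64 * (δ * (1 + 2 * δ) ^ 2 / 2) ^ 2 :=
      mul_le_mul_of_nonneg_left hY (by norm_num)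
    have hring : 64 * (δ * (1 + 2 * δ) ^ 2 / 2) ^ 2 = 16 * δ ^ 2 * (1 + 2 * δ) ^ 4 := by ring
    linarith
  -- (5) back to the excess of the big cube at time 2t, then down to its own quarter-time k'+2 ≥ 2t
  have hx't : exc (Z L' L' L') (2 * k + 2 + 2) ≤ Real.exp (16 * δ ^ 2 * (1 + 2 * δ) ^ 4) - 1 := by
    rw [exc_eq_exp_Yfun hz' (2 * k + 2)]
    linarith [Real.exp_le_exp.2 hY']
  have hx'k' : exc (Z L' L' L') (k' + 2) ≤ exc (Z L' L' L') (2 * k + 2 + 2) := exc_antitone hz' hkk'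
  calc δ' ≤ 2 * exc (Z L' L' L') (k' + 2) := hδ'x
    _ ≤ 2 * exc (Z L' L' L') (2 * k + 2 + 2) := by linarith
    _ ≤ 2 * (Real.exp (16 * δ ^ 2 * (1 + 2 * δ) ^ 4) - 1) := by linarith

/-- numerical heart: `0 ≤ δ ≤ u ≤ 2⁻⁶ ⇒ 2 (exp (16 δ²(1+2δ)⁴) − 1) ≤ 37 u²` (`exp x − 1 ≤ x + x²` on `|x| ≤ 1`). -/
theorem sq_step6 {δ u : ℝ} (h0 : 0 ≤ δ) (hu : δ ≤ u) (hu6 : u ≤ 1 / 2 ^ 6) :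
    2 * (Real.exp (16 * δ ^ 2 * (1 + 2 * δ) ^ 4) - 1) ≤ 37 * u ^ 2 := by
  set A : ℝ := 16 * δ ^ 2 * (1 + 2 * δ) ^ 4 with hA
  have hu0 : 0 ≤ u := h0.trans hu
  have hA0 : 0 ≤ A := by positivity
  have h12 : (1 + 2 * δ) ^ 4 ≤ (1 + 2 * (1 / 2 ^ 6 : ℝ)) ^ 4 :=
    pow_le_pow_left₀ (by linarith) (by linarith) 4
  have hc4 : (1 + 2 * (1 / 2 ^ 6 : ℝ)) ^ 4 ≤ 1.131 := by norm_num
  have hδu2 : δ ^ 2 ≤ u ^ 2 := pow_le_pow_left₀ h0 hu 2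
  have hA1 : A ≤ 18.1 * u ^ 2 := by
    have h1 : 16 * δ ^ 2 * (1 + 2 * δ) ^ 4 ≤ 16 * u ^ 2 * (1 + 2 * δ) ^ 4 :=
      mul_le_mul_of_nonneg_right (by linarith) (by positivity)
    have h2 : 16 * u ^ 2 * (1 + 2 * δ) ^ 4 ≤ 16 * u ^ 2 * 1.131 :=
      mul_le_mul_of_nonneg_left (h12.trans hc4) (by positivity)
    rw [hA]; linarith
  have hu2 : u ^ 2 ≤ (1 / 2 ^ 6 : ℝ) ^ 2 := pow_le_pow_left₀ hu0 hu6 2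
  have hAsmall : A ≤ 18.1 / 2 ^ 12 := by
    have : 18.1 * u ^ 2 ≤ 18.1 * (1 / 2 ^ 6 : ℝ) ^ 2 := mul_le_mul_of_nonneg_left hu2 (by norm_num)
    have h' : 18.1 * (1 / 2 ^ 6 : ℝ) ^ 2 = 18.1 / 2 ^ 12 := by norm_num
    linarith
  have hAle1 : |A| ≤ 1 := by
    rw [abs_of_nonneg hA0]; exact hAsmall.trans (by norm_num)
  have hexp : Real.exp A - 1 ≤ A + A ^ 2 := by
    have := Real.abs_exp_sub_one_sub_id_le hAle1
    have := (abs_le.1 this).2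
    linarith
  have hA2 : A ^ 2 ≤ A * (18.1 / 2 ^ 12) := by
    rw [sq]; exact mul_le_mul_of_nonneg_left hAsmall hA0
  have hsum : A + A ^ 2 ≤ (1 + 18.1 / 2 ^ 12) * A := by linarith
  have hfin : (1 + 18.1 / 2 ^ 12) * A ≤ (1 + 18.1 / 2 ^ 12) * (18.1 * u ^ 2) :=
    mul_le_mul_of_nonneg_left hA1 (by norm_num)
  have hnum : 2 * ((1 + 18.1 / 2 ^ 12) * (18.1 * u ^ 2)) ≤ 37 * u ^ 2 := by
    have : 2 * ((1 + 18.1 / 2 ^ 12) * 18.1) ≤ (37 : ℝ) := by norm_num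
    nlinarith [sq_nonneg u]
  linarith

/-- One exact doubling below `2⁻⁶`: `boxDefect Z L ≤ u ≤ 2⁻⁶ ⇒ boxDefect Z (2L) ≤ 37 u²` (no volume bounds). -/
theorem basin_step6 (hS : IsAxisSymmetric Z) (hT : IsTracePositive Z)
    (L : ℕ) (hL : 8 ≤ L) {u : ℝ} (hu : boxDefect Z L ≤ u) (hu6 : u ≤ 1 / 2 ^ 6) :
    boxDefect Z (2 * L) ≤ 37 * u ^ 2 :=
  (defectSquaring_double_timeFirst hS hT L hL ((hu.trans hu6).trans (by norm_num))).trans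
    (sq_step6 (boxDefect_nonneg_of_le hT L hL) hu hu6)

end Rung6

/-- **PROVED RUNG 2⁻⁶** (= stub `BasinTransfer.stub_abstractBasin64` of line `basin-transfer`): `AbstractBasin (1/2^6) (1/2^8)` — two exact doublings. -/
theorem abstractBasin_two_pow_6 : AbstractBasin (1 / 2 ^ 6) (1 / 2 ^ 8) := by
  intro Z hS hT _hV L hL hδ
  have h1 := basin_step6 hS hT L hL hδ le_rfl
  have h2 := basin_step6 hS hT (2 * L) (by omega) h1 (by norm_num)
  exact ⟨2 * (2 * L), by omega, h2.trans (by norm_num)⟩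

/-- `AbstractBasin (1/2^6) epsStar`: compose with the landed rungs `2⁻⁸ → 2⁻⁹ → 2⁻²⁴`. -/
theorem abstractBasin_two_pow_6_epsStar : AbstractBasin (1 / 2 ^ 6) epsStar :=
  abstractBasin_trans abstractBasin_two_pow_6 abstractBasin_two_pow_8_epsStar

/-- **The bill with the seed at ONE tolerance `2⁻⁶` at ONE scale**: `ColdExitAt (1/2^6) → AFToColdPressure → IRnsc → IR`. -/
theorem IR_of_exitAt6 (hE : ColdExitAt (1 / 2 ^ 6)) (hX : AFToColdPressure) (hN : IRnsc) :
    Summit.QuantumFields.YangMills.Theses.BalabanLadder.IR :=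
  IR_of_exitAt8 (coldExitAt_of_abstractBasin hE abstractBasin_two_pow_6) hX hN

/-- Monotone packaging: any tolerance `θ ≤ 2⁻⁶` at one scale suffices. -/
theorem IR_of_exitAt_le6 {θ : ℝ} (hθ : θ ≤ 1 / 2 ^ 6) (hE : ColdExitAt θ) (hX : AFToColdPressure) (hN : IRnsc) :
    Summit.QuantumFields.YangMills.Theses.BalabanLadder.IR :=
  IR_of_exitAt6 (coldExitAt_mono hθ hE) hX hN

end Summit.QuantumFields.YangMills.Cruxes.IR.BasinRung

end
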